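import Mathlib

/-!
# `BalabanUV.Beta.FP.GradedIteratedDeriv` — road «FP» for binder row D1, leaf H2-P of the horizontal route, row H2-P-REG (owner ruling R-FP-17), PART 1:
# a ONE-VARIABLE TOOLKIT — «graded» bounds `‖f^{(n)}(x)‖ ≤ C·ρ^{m−n}` (`n ≤ 3`, truncated exponent) are stable under products (Leibniz, Mathlib
# `norm_iteratedFDeriv_mul_le`), sums, scalars; the atoms `t ↦ e^{±it} − 1` of the lattice momentum factors are graded of order 1

HONEST DEPENDENCY (page 1, mandatory): continuum YM on T⁴ ⇐ BetaPertH ∧ nine spine estimates (0/9 proved); BetaPertH ⇐ (D1) ∧ (D4) ∧ CAP+tail;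
G-an2-4 gates asym, D1 and NE2/3/4.  HONEST FRAMING (cell contract, verbatim): «discharging `BetaPertH` makes Bałaban's UV stability UNCONDITIONAL —
a real constructive-QFT result; it is NOT the continuum limit and NOT the Clay problem.»  THIS MODULE DISCHARGES NOTHING of the wall: [folklore] one-variable
calculus over Mathlib's `iteratedDeriv` / `ContDiff` API (`norm_iteratedFDeriv_mul_le`, `norm_iteratedFDeriv_eq_norm_iteratedDeriv`, `iteratedDeriv_add`,
`iteratedDeriv_const_mul`, `iteratedDeriv_succ`) and Mathlib's chord bound `Real.norm_exp_I_mul_ofReal_sub_one_le`.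
0 def; no `def … : Prop`; nothing cited; 0 sorry; 0 wall binders; NOT D1, NOT BetaPertH, NOT continuum, NOT Clay.

ABSOLUTE RULE (cell charter, verbatim): «No internally-minted statement may enter as a cited fact. Every hypothesis is either kernel-proved in this package or a
verbatim quotation of a PUBLISHED theorem with page reference. The manuscript(s) under audit are NOT citable for their own disputed steps — they are the thing
under adjudication; programme-internal (2001/route/tribunal) claims are never citable.»

WHY (R-FP-17 rows H2-P-REG → H2-P-INV-BND / H2-P-B → H2-P-IBP).  The rate `|K_B(z)| ≤ C/‖z‖³` of the remainder kernel of the unconstrained perfect propagator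
is obtained by three 1-D integrations by parts (leaf-05-g34's `FP/PuncturedCoordDeriv`), which consume, entry by entry and coordinate by coordinate, derivative
CHAINS of the symbol with bounds of «symbol-class» shape `‖∂ᵏ·‖ ≤ C‖s‖^{order−k}`.  Row H2-P-REG supplies these for the Feynman-completed weighted Maxwell matrix
`feynMat (Re W_∞) p̂` (order 2) and for the excess `maxwellMat (Re W_∞ − 1) p̂` (order 4).  This part is the abstract bookkeeping: along a coordinate slice every
entry is a finite sum of products (weight) × (e^{−is_a} − 1 or constant) × (e^{is_b} − 1 or constant), and graded bounds multiply (orders add) and add.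
«GRADED of order `m`, constant `C`, scale `ρ` at `x`» below always means the DISPLAYED hypothesis `∀ n ≤ 3, ‖iteratedDeriv n f x‖ ≤ C * ρ ^ (m - n)` (ℕ-truncated
exponent; no predicate is introduced).

WHAT.
* §1 exponent bookkeeping `pow_le_pow_mul_pow`; `graded_mono`; `graded_of_le_order` (lower the order at the cost `M^{m−m′}` when `0 ≤ ρ ≤ M`, `1 ≤ M`).
* §2 **`graded_mul`**: graded `(m, C)` × graded `(m′, C′)` ⟹ graded `(m + m′, 8·M^{m+m′}·C·C′)` for `ContDiff ℝ 3` factors, `0 ≤ ρ ≤ M`, `1 ≤ M`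
  (Leibniz bound `norm_iteratedFDeriv_mul_le` in `iteratedDeriv` currency — `norm_iteratedDeriv_mul_le` —, `Σ_{i≤n} C(n,i) ≤ 8` for `n ≤ 3`, and
  `(m−i)⁺ + (m′−(n−i))⁺ ≥ (m+m′−n)⁺`).
* §3 `graded_add`, `graded_sum` (finite sums), `graded_const_mul`, `graded_const` (a constant `c` with `‖c‖ ≤ C·ρ^m` is graded of order `m`).
* §4 THE ATOMS: `iteratedDeriv_cexp_const_mul` (`(t ↦ e^{ct})^{(n)} = cⁿe^{ct}`), `iteratedDeriv_cexpI`, `iteratedDeriv_cexpNegI`, `iteratedDeriv_sub_const`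
  (`n ≥ 1`), `contDiff_expSub`/`contDiff_expNegSub`, `norm_expNegSub_le` (`‖e^{−it} − 1‖ ≤ |t|`; the `+` case is Mathlib's `Real.norm_exp_I_mul_ofReal_sub_one_le`), and **`graded_expSub`** /
  **`graded_expNegSub`**: `|x| ≤ ρ ⟹ t ↦ e^{±it} − 1` is graded `(1, 1)` at `x`.
PART 2 (`FP/MaxwellSymbolDeriv`) assembles the weighted Maxwell / Feynman entries along coordinate slices of the Brillouin zone.
Provenance: binder row G-an2-4 owner lineage gan24-p3, gen 16 (prover-b2b-balaban-gan24-p3-g16-0), 2026-08-20; supplier of road FP's H2-P-REG (owner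
b2b-balaban-beta-d1-p3, R-FP-17).
-/

noncomputable section

namespace Summit.QuantumFields.BalabanUV.Beta.FP.GradedIteratedDeriv

open Complex
open scoped BigOperators

/-! ## §1 Exponent bookkeeping; lowering the order -/

/-- [folklore] for `0 ≤ ρ ≤ M`, `1 ≤ M`, `e′ ≤ e`, `e − e′ ≤ k`: `ρ^e ≤ M^k·ρ^{e′}`. -/
theorem pow_le_pow_mul_pow {ρ M : ℝ} (hρ : 0 ≤ ρ) (hρM : ρ ≤ M) (hM : 1 ≤ M) {e e' k : ℕ} (he : e' ≤ e) (hk : e - e' ≤ k) :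
    ρ ^ e ≤ M ^ k * ρ ^ e' := by
  have h1 : ρ ^ e = ρ ^ (e - e') * ρ ^ e' := by rw [← pow_add, Nat.sub_add_cancel he]
  rw [h1]
  refine mul_le_mul_of_nonneg_right ?_ (pow_nonneg hρ _)
  exact (pow_le_pow_left₀ hρ hρM _).trans (pow_le_pow_right₀ hM hk)

/-- [folklore] monotonicity of a graded bound in the constant (`0 ≤ ρ`). -/
theorem graded_mono {m : ℕ} {C C' ρ : ℝ} {f : ℝ → ℂ} {x : ℝ} (hF : ∀ n ≤ 3, ‖iteratedDeriv n f x‖ ≤ C * ρ ^ (m - n)) (hC : C ≤ C')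
    (hρ : 0 ≤ ρ) : ∀ n ≤ 3, ‖iteratedDeriv n f x‖ ≤ C' * ρ ^ (m - n) :=
  fun n hn => (hF n hn).trans (mul_le_mul_of_nonneg_right hC (pow_nonneg hρ _))

/-- [folklore] LOWERING THE ORDER: graded `(m, C)` ⟹ graded `(m′, M^{m−m′}·C)` for `m′ ≤ m`, `0 ≤ C`, `0 ≤ ρ ≤ M`, `1 ≤ M`. -/
theorem graded_of_le_order {m m' : ℕ} {C ρ M : ℝ} {f : ℝ → ℂ} {x : ℝ} (hF : ∀ n ≤ 3, ‖iteratedDeriv n f x‖ ≤ C * ρ ^ (m - n)) (hC : 0 ≤ C)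
    (hm : m' ≤ m) (hρ : 0 ≤ ρ) (hρM : ρ ≤ M) (hM : 1 ≤ M) : ∀ n ≤ 3, ‖iteratedDeriv n f x‖ ≤ M ^ (m - m') * C * ρ ^ (m' - n) := by
  intro n hn
  refine (hF n hn).trans ?_
  calc C * ρ ^ (m - n) ≤ C * (M ^ (m - m') * ρ ^ (m' - n)) :=
        mul_le_mul_of_nonneg_left (pow_le_pow_mul_pow hρ hρM hM (by omega) (by omega)) hC
    _ = M ^ (m - m') * C * ρ ^ (m' - n) := by ring

/-! ## §2 Products (Leibniz) -/

/-- [folklore] the Leibniz BOUND in `iteratedDeriv` currency (Mathlib `norm_iteratedFDeriv_mul_le`): for `ContDiff ℝ 3` functions and `n ≤ 3`,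
`‖(fg)^{(n)}(x)‖ ≤ Σ_{i ≤ n} C(n,i)·‖f^{(i)}(x)‖·‖g^{(n−i)}(x)‖`. -/
theorem norm_iteratedDeriv_mul_le {f g : ℝ → ℂ} (hf : ContDiff ℝ 3 f) (hg : ContDiff ℝ 3 g) (x : ℝ) {n : ℕ} (hn : n ≤ 3) :
    ‖iteratedDeriv n (fun y => f y * g y) x‖
      ≤ ∑ i ∈ Finset.range (n + 1), (n.choose i : ℝ) * ‖iteratedDeriv i f x‖ * ‖iteratedDeriv (n - i) g x‖ := by
  have h := norm_iteratedFDeriv_mul_le (𝕜 := ℝ) (N := 3) hf hg x (n := n) (by exact_mod_cast hn)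
  simp only [norm_iteratedFDeriv_eq_norm_iteratedDeriv] at h
  exact h

/-- [folklore] `Σ_{i ≤ n} C(n,i) = 2^n ≤ 8` for `n ≤ 3`. -/
theorem sum_choose_le_eight {n : ℕ} (hn : n ≤ 3) : ∑ i ∈ Finset.range (n + 1), (n.choose i : ℝ) ≤ 8 := by
  have h : ∑ i ∈ Finset.range (n + 1), (n.choose i : ℝ) = (2 : ℝ) ^ n := by exact_mod_cast Nat.sum_range_choose n
  rw [h]
  calc (2 : ℝ) ^ n ≤ 2 ^ 3 := pow_le_pow_right₀ (by norm_num) hn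
    _ = 8 := by norm_num

/-- [folklore] **PRODUCTS OF GRADED FUNCTIONS ARE GRADED, ORDERS ADD**: graded `(m, C)` and `(m′, C′)` at `x`, both `ContDiff ℝ 3`, `0 ≤ C, C′`,
`0 ≤ ρ ≤ M`, `1 ≤ M` ⟹ the product is graded `(m + m′, 8·M^{m+m′}·C·C′)` at `x`. -/
theorem graded_mul {m m' : ℕ} {C C' ρ M : ℝ} {f g : ℝ → ℂ} {x : ℝ} (hf : ContDiff ℝ 3 f) (hg : ContDiff ℝ 3 g) (hC : 0 ≤ C) (hC' : 0 ≤ C')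
    (hF : ∀ n ≤ 3, ‖iteratedDeriv n f x‖ ≤ C * ρ ^ (m - n)) (hG : ∀ n ≤ 3, ‖iteratedDeriv n g x‖ ≤ C' * ρ ^ (m' - n))
    (hρ : 0 ≤ ρ) (hρM : ρ ≤ M) (hM : 1 ≤ M) :
    ∀ n ≤ 3, ‖iteratedDeriv n (fun y => f y * g y) x‖ ≤ 8 * M ^ (m + m') * C * C' * ρ ^ (m + m' - n) := by
  intro n hn
  have hM0 : 0 ≤ M := zero_le_one.trans hM
  have hterm : ∀ i ∈ Finset.range (n + 1),
      (n.choose i : ℝ) * ‖iteratedDeriv i f x‖ * ‖iteratedDeriv (n - i) g x‖ ≤ (n.choose i : ℝ) * (M ^ (m + m') * C * C' * ρ ^ (m + m' - n)) := by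
    intro i hi
    have hi' : i ≤ n := Nat.lt_succ_iff.mp (Finset.mem_range.mp hi)
    have h1 := hF i (hi'.trans hn)
    have h2 := hG (n - i) ((Nat.sub_le n i).trans hn)
    have hpow : ρ ^ (m - i) * ρ ^ (m' - (n - i)) ≤ M ^ (m + m') * ρ ^ (m + m' - n) := by
      rw [← pow_add]
      exact pow_le_pow_mul_pow hρ hρM hM (by omega) (by omega)
    rw [mul_assoc]
    refine mul_le_mul_of_nonneg_left ?_ (Nat.cast_nonneg _)
    calc ‖iteratedDeriv i f x‖ * ‖iteratedDeriv (n - i) g x‖ ≤ (C * ρ ^ (m - i)) * (C' * ρ ^ (m' - (n - i))) :=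
          mul_le_mul h1 h2 (norm_nonneg _) ((norm_nonneg _).trans h1)
      _ = C * C' * (ρ ^ (m - i) * ρ ^ (m' - (n - i))) := by ring
      _ ≤ C * C' * (M ^ (m + m') * ρ ^ (m + m' - n)) := mul_le_mul_of_nonneg_left hpow (mul_nonneg hC hC')
      _ = M ^ (m + m') * C * C' * ρ ^ (m + m' - n) := by ring
  calc ‖iteratedDeriv n (fun y => f y * g y) x‖
      ≤ ∑ i ∈ Finset.range (n + 1), (n.choose i : ℝ) * ‖iteratedDeriv i f x‖ * ‖iteratedDeriv (n - i) g x‖ := norm_iteratedDeriv_mul_le hf hg x hn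
    _ ≤ ∑ i ∈ Finset.range (n + 1), (n.choose i : ℝ) * (M ^ (m + m') * C * C' * ρ ^ (m + m' - n)) := Finset.sum_le_sum hterm
    _ = (∑ i ∈ Finset.range (n + 1), (n.choose i : ℝ)) * (M ^ (m + m') * C * C' * ρ ^ (m + m' - n)) := by rw [Finset.sum_mul]
    _ ≤ 8 * (M ^ (m + m') * C * C' * ρ ^ (m + m' - n)) :=
        mul_le_mul_of_nonneg_right (sum_choose_le_eight hn) (by positivity)
    _ = 8 * M ^ (m + m') * C * C' * ρ ^ (m + m' - n) := by ring

/-! ## §3 Sums, scalars, constants -/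

/-- [folklore] **SUMS**: graded `(m, C)` + graded `(m, C′)` ⟹ graded `(m, C + C′)` (both `ContDiff ℝ 3`). -/
theorem graded_add {m : ℕ} {C C' ρ : ℝ} {f g : ℝ → ℂ} {x : ℝ} (hf : ContDiff ℝ 3 f) (hg : ContDiff ℝ 3 g)
    (hF : ∀ n ≤ 3, ‖iteratedDeriv n f x‖ ≤ C * ρ ^ (m - n)) (hG : ∀ n ≤ 3, ‖iteratedDeriv n g x‖ ≤ C' * ρ ^ (m - n)) :
    ∀ n ≤ 3, ‖iteratedDeriv n (fun y => f y + g y) x‖ ≤ (C + C') * ρ ^ (m - n) := by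
  intro n hn
  have hn' : (n : WithTop ℕ∞) ≤ 3 := by exact_mod_cast hn
  have e : (fun y => f y + g y) = f + g := rfl
  rw [e, iteratedDeriv_add ((hf.of_le hn').contDiffAt) ((hg.of_le hn').contDiffAt)]
  calc ‖iteratedDeriv n f x + iteratedDeriv n g x‖ ≤ ‖iteratedDeriv n f x‖ + ‖iteratedDeriv n g x‖ := norm_add_le _ _
    _ ≤ C * ρ ^ (m - n) + C' * ρ ^ (m - n) := add_le_add (hF n hn) (hG n hn)
    _ = (C + C') * ρ ^ (m - n) := by ring

/-- [folklore] **SCALARS**: graded `(m, C)` ⟹ `c·f` graded `(m, ‖c‖·C)`. -/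
theorem graded_const_mul {m : ℕ} {C ρ : ℝ} {f : ℝ → ℂ} {x : ℝ} (hf : ContDiff ℝ 3 f)
    (hF : ∀ n ≤ 3, ‖iteratedDeriv n f x‖ ≤ C * ρ ^ (m - n)) (c : ℂ) :
    ∀ n ≤ 3, ‖iteratedDeriv n (fun y => c * f y) x‖ ≤ ‖c‖ * C * ρ ^ (m - n) := by
  intro n hn
  have hn' : (n : WithTop ℕ∞) ≤ 3 := by exact_mod_cast hn
  rw [iteratedDeriv_const_mul c ((hf.of_le hn').contDiffAt), norm_mul, mul_assoc]
  exact mul_le_mul_of_nonneg_left (hF n hn) (norm_nonneg _)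

/-- [folklore] **CONSTANTS**: if `‖c‖ ≤ C·ρ^m` (`0 ≤ C`, `0 ≤ ρ`) then the constant function is graded of order `m`. -/
theorem graded_const {m : ℕ} {C ρ : ℝ} (c : ℂ) (hC : 0 ≤ C) (hρ : 0 ≤ ρ) (hc : ‖c‖ ≤ C * ρ ^ m) (x : ℝ) :
    ∀ n ≤ 3, ‖iteratedDeriv n (fun _ : ℝ => c) x‖ ≤ C * ρ ^ (m - n) := by
  intro n hn
  rcases Nat.eq_zero_or_pos n with h0 | hpos
  · subst h0; simpa using hc
  · have e : iteratedDeriv n (fun _ : ℝ => c) x = 0 := by rw [iteratedDeriv_const]; simp [hpos.ne']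
    rw [e, norm_zero]; positivity

/-- [folklore] **FINITE SUMS**: if every `f i` (`i ∈ s`) is `ContDiff ℝ 3` and graded `(m, C i)` at `x` then `Σ_{i∈s} f i` is graded `(m, Σ_{i∈s} C i)`. -/
theorem graded_sum {ι : Type*} (s : Finset ι) {m : ℕ} {C : ι → ℝ} {ρ : ℝ} {f : ι → ℝ → ℂ} {x : ℝ}
    (hf : ∀ i ∈ s, ContDiff ℝ 3 (f i)) (hF : ∀ i ∈ s, ∀ n ≤ 3, ‖iteratedDeriv n (f i) x‖ ≤ C i * ρ ^ (m - n)) :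
    ∀ n ≤ 3, ‖iteratedDeriv n (fun y => ∑ i ∈ s, f i y) x‖ ≤ (∑ i ∈ s, C i) * ρ ^ (m - n) := by
  classical
  induction s using Finset.induction_on with
  | empty =>
    intro n hn
    simp only [Finset.sum_empty, zero_mul]
    have e : iteratedDeriv n (fun _ : ℝ => (0 : ℂ)) x = 0 := by
      rw [iteratedDeriv_const]; split_ifs <;> rfl
    rw [e, norm_zero]
  | @insert j s hj ih =>
    have hf' : ∀ i ∈ s, ContDiff ℝ 3 (f i) := fun i hi => hf i (Finset.mem_insert_of_mem hi)
    have hF' : ∀ i ∈ s, ∀ n ≤ 3, ‖iteratedDeriv n (f i) x‖ ≤ C i * ρ ^ (m - n) := fun i hi => hF i (Finset.mem_insert_of_mem hi)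
    have hsum : ContDiff ℝ 3 (fun y => ∑ i ∈ s, f i y) := ContDiff.sum fun i hi => hf' i hi
    have h := graded_add (hf j (Finset.mem_insert_self j s)) hsum (hF j (Finset.mem_insert_self j s)) (ih hf' hF')
    have e : (fun y => ∑ i ∈ insert j s, f i y) = fun y => f j y + ∑ i ∈ s, f i y := by
      funext y; rw [Finset.sum_insert hj]
    rw [Finset.sum_insert hj, e]
    exact h

/-! ## §4 The atoms `t ↦ e^{±it}` and `t ↦ e^{±it} − 1` -/

/-- [folklore] the derivative of `t ↦ e^{ct}` (real variable, complex constant `c`) is `c·e^{ct}`. -/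
theorem hasDerivAt_cexp_const_mul (c : ℂ) (t : ℝ) : HasDerivAt (fun u : ℝ => cexp (c * (u : ℂ))) (c * cexp (c * (t : ℂ))) t := by
  have h1 : HasDerivAt (fun u : ℝ => c * (u : ℂ)) (c * 1) t := (hasDerivAt_id t).ofReal_comp.const_mul c
  convert h1.cexp using 1
  ring

/-- [folklore] `t ↦ e^{ct}`: `ContDiff ℝ ⊤`. -/
theorem contDiff_cexp_const_mul (c : ℂ) {n : WithTop ℕ∞} : ContDiff ℝ n (fun u : ℝ => cexp (c * (u : ℂ))) :=
  (contDiff_const.mul Complex.ofRealCLM.contDiff).cexp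

/-- [folklore] **`(t ↦ e^{ct})^{(n)} = cⁿ·e^{ct}`.** -/
theorem iteratedDeriv_cexp_const_mul (c : ℂ) (n : ℕ) :
    iteratedDeriv n (fun u : ℝ => cexp (c * (u : ℂ))) = fun u : ℝ => c ^ n * cexp (c * (u : ℂ)) := by
  induction n with
  | zero => funext u; simp
  | succ n ih =>
    rw [iteratedDeriv_succ, ih]
    funext u
    have h : HasDerivAt (fun v : ℝ => c ^ n * cexp (c * (v : ℂ))) (c ^ n * (c * cexp (c * (u : ℂ)))) u :=
      (hasDerivAt_cexp_const_mul c u).const_mul (c ^ n)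
    rw [h.deriv]; ring

/-- [folklore] `t ↦ e^{it}` is `t ↦ e^{c t}` with `c = i`. -/
theorem cexpI_eq : (fun u : ℝ => cexp ((u : ℂ) * I)) = fun u : ℝ => cexp (I * (u : ℂ)) := by
  funext u; rw [mul_comm]

/-- [folklore] `t ↦ e^{−it}` is `t ↦ e^{c t}` with `c = −i`. -/
theorem cexpNegI_eq : (fun u : ℝ => cexp (-((u : ℂ) * I))) = fun u : ℝ => cexp (-I * (u : ℂ)) := by
  funext u; ring_nf

/-- [folklore] `(t ↦ e^{it})^{(n)} = iⁿe^{it}`. -/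
theorem iteratedDeriv_cexpI (n : ℕ) (t : ℝ) : iteratedDeriv n (fun u : ℝ => cexp ((u : ℂ) * I)) t = I ^ n * cexp ((t : ℂ) * I) := by
  rw [cexpI_eq, iteratedDeriv_cexp_const_mul, mul_comm (t : ℂ)]

/-- [folklore] `(t ↦ e^{−it})^{(n)} = (−i)ⁿe^{−it}`. -/
theorem iteratedDeriv_cexpNegI (n : ℕ) (t : ℝ) :
    iteratedDeriv n (fun u : ℝ => cexp (-((u : ℂ) * I))) t = (-I) ^ n * cexp (-((t : ℂ) * I)) := by
  rw [cexpNegI_eq, iteratedDeriv_cexp_const_mul]; ring_nf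

/-- [folklore] `t ↦ e^{it}`: `ContDiff ℝ ⊤`. -/
theorem contDiff_cexpI {n : WithTop ℕ∞} : ContDiff ℝ n (fun u : ℝ => cexp ((u : ℂ) * I)) := by
  rw [cexpI_eq]; exact contDiff_cexp_const_mul I

/-- [folklore] `t ↦ e^{−it}`: `ContDiff ℝ ⊤`. -/
theorem contDiff_cexpNegI {n : WithTop ℕ∞} : ContDiff ℝ n (fun u : ℝ => cexp (-((u : ℂ) * I))) := by
  rw [cexpNegI_eq]; exact contDiff_cexp_const_mul (-I)

/-- [folklore] subtracting a constant does not change derivatives of order `≥ 1`. -/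
theorem iteratedDeriv_sub_const {f : ℝ → ℂ} (hf : ContDiff ℝ (⊤ : ℕ∞) f) (c : ℂ) {n : ℕ} (hn : 1 ≤ n) (t : ℝ) :
    iteratedDeriv n (fun u => f u - c) t = iteratedDeriv n f t := by
  have h1 : ContDiffAt ℝ (n : WithTop ℕ∞) f t := (hf.of_le (by exact_mod_cast le_top)).contDiffAt
  have h2 : ContDiffAt ℝ (n : WithTop ℕ∞) (fun _ : ℝ => -c) t := contDiffAt_const
  have e : (fun u => f u - c) = f + fun _ => -c := by funext u; simp [sub_eq_add_neg]
  rw [e, iteratedDeriv_add h1 h2, iteratedDeriv_const]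
  have : n ≠ 0 := by omega
  simp [this]

/-- [folklore] `t ↦ e^{it} − 1`: `ContDiff ℝ ⊤`. -/
theorem contDiff_expSub {n : WithTop ℕ∞} : ContDiff ℝ n (fun t : ℝ => cexp ((t : ℂ) * I) - 1) := contDiff_cexpI.sub contDiff_const

/-- [folklore] `t ↦ e^{−it} − 1`: `ContDiff ℝ ⊤`. -/
theorem contDiff_expNegSub {n : WithTop ℕ∞} : ContDiff ℝ n (fun t : ℝ => cexp (-((t : ℂ) * I)) - 1) := contDiff_cexpNegI.sub contDiff_const

/-- [folklore] `‖e^{−it} − 1‖ ≤ |t|` (Mathlib's chord bound `Real.norm_exp_I_mul_ofReal_sub_one_le` at `−t`). -/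
theorem norm_expNegSub_le (t : ℝ) : ‖cexp (-((t : ℂ) * I)) - 1‖ ≤ |t| := by
  have h := Real.norm_exp_I_mul_ofReal_sub_one_le (x := -t)
  have e : I * (((-t : ℝ)) : ℂ) = -((t : ℂ) * I) := by push_cast; ring
  rw [e, Real.norm_eq_abs, abs_neg] at h
  exact h

/-- [folklore] **THE MOVING ATOM IS GRADED OF ORDER 1**: `|x| ≤ ρ` ⟹ `t ↦ e^{it} − 1` is graded `(1, 1)` at `x`. -/
theorem graded_expSub {x ρ : ℝ} (hx : |x| ≤ ρ) :
    ∀ n ≤ 3, ‖iteratedDeriv n (fun t : ℝ => cexp ((t : ℂ) * I) - 1) x‖ ≤ 1 * ρ ^ (1 - n) := by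
  intro n hn
  rcases Nat.eq_zero_or_pos n with h0 | hpos
  · subst h0
    have hc : ‖cexp ((x : ℂ) * I) - 1‖ ≤ |x| := by
      have h := Real.norm_exp_I_mul_ofReal_sub_one_le (x := x)
      rwa [mul_comm, Real.norm_eq_abs] at h
    simpa using hc.trans hx
  · rw [iteratedDeriv_sub_const contDiff_cexpI 1 hpos, iteratedDeriv_cexpI, norm_mul, norm_pow, Complex.norm_I, one_pow, one_mul,
      Complex.norm_exp_ofReal_mul_I]
    have : 1 - n = 0 := by omega
    simp [this]

/-- [folklore] **THE CONJUGATE MOVING ATOM IS GRADED OF ORDER 1**: `|x| ≤ ρ` ⟹ `t ↦ e^{−it} − 1` is graded `(1, 1)` at `x`. -/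
theorem graded_expNegSub {x ρ : ℝ} (hx : |x| ≤ ρ) :
    ∀ n ≤ 3, ‖iteratedDeriv n (fun t : ℝ => cexp (-((t : ℂ) * I)) - 1) x‖ ≤ 1 * ρ ^ (1 - n) := by
  intro n hn
  rcases Nat.eq_zero_or_pos n with h0 | hpos
  · subst h0; simpa using (norm_expNegSub_le x).trans hx
  · rw [iteratedDeriv_sub_const contDiff_cexpNegI 1 hpos, iteratedDeriv_cexpNegI, norm_mul, norm_pow, norm_neg, Complex.norm_I, one_pow,
      one_mul]
    have e : -((x : ℂ) * I) = ((-x : ℝ) : ℂ) * I := by push_cast; ring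
    rw [e, Complex.norm_exp_ofReal_mul_I]
    have : 1 - n = 0 := by omega
    simp [this]

end Summit.QuantumFields.BalabanUV.Beta.FP.GradedIteratedDeriv

end
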